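/-
HONEST FRAMING: certified error envelopes and provably optimal rounding/accumulation schemes for
low-precision formats under stated cost models; every table by two implementations; no hardware
or vendor claims.
-/
import Summits.Ventures.CertifiedArithmetic.LowPrec.OptDemotionBudgetCheck
import Summits.Ventures.CertifiedArithmetic.LowPrec.OptDemotionGoodActiveCex

/-!
# The demotion law (Theorem T8), part 7d′: KERNEL CERTIFICATES of Conjecture D via `Φ*` at q = 5

`decide +kernel` evaluations of `budgetCheck 5 3` and `budgetCheck 5 2` (part 7c) and the resulting
theorems `s ≤ Q_t · fl_p(ŝ)` for ALL nonnegative `F(5, emin)` data and ANY nearest roundings: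
* `(q,p) = (5,3)` and `(5,2)`: every summation tree with at most 5 summands
  (`conjectureD_5_3_of_le_five`, `conjectureD_5_2_of_le_five`);
* `(5,3)`: every tree of the shape of part 6e's 43-leaf GOOD-ACTIVE counterexample `gaCex43`
  (`conjectureD_gaCex43`).
With the every-tree witness `demotion_tree_witness` (part 4) these are EXACT: `D_t = Q_t`.  Cost:
≈1 s of kernel time per internal node at `q = 5`; each `decide` stays well below a minute.  Part 7d
(`OptDemotionBudgetCert`) has `(4,2)`.
-/

namespace Summit.Ventures.CertifiedArithmetic.LowPrec.Opt

open Literature.ComputerArithmetic.JeannerodRump2018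
open Literature.ComputerArithmetic.JeannerodRump2018.SumTree

/-! ## Kernel certificates at q = 5 (part 7d′) -/

/-- Reassembling a `List.all` cut in two with `take` / `drop`. -/
theorem all_of_take_drop {α : Type} (l : List α) (f : α → Bool) (k : ℕ)
    (h1 : (l.take k).all f = true) (h2 : (l.drop k).all f = true) : l.all f = true := by
  rw [← List.take_append_drop k l, List.all_append, h1, h2]; rfl

/-- Extending a certificate over `shapesUpTo N` by the shapes with `N + 1` leaves. -/
theorem all_shapesUpTo_succ' {q p N : ℕ} (h1 : (shapesUpTo N).all (budgetCheck q p) = true)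
    (h2 : (shapesN (N + 1)).all (budgetCheck q p) = true) :
    (shapesUpTo (N + 1)).all (budgetCheck q p) = true := by
  have e : shapesUpTo (N + 1) = shapesUpTo N ++ shapesN (N + 1) := by
    simp [shapesUpTo, List.range_succ, List.flatMap_append]
  rw [e, List.all_append, h1, h2]; rfl

section Certificates

/-- (q,p) = (5,3): every shape with ≤ 4 leaves. -/
theorem budgetCheck_5_3_upTo4 : (shapesUpTo 4).all (budgetCheck 5 3) = true := by decide +kernel
/-- (5,3), the 14 shapes with 5 leaves, first half. -/
theorem budgetCheck_5_3_five_0 : ((shapesN 5).take 7).all (budgetCheck 5 3) = true := by decide +kernel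
/-- (5,3), 5 leaves, second half. -/
theorem budgetCheck_5_3_five_1 : ((shapesN 5).drop 7).all (budgetCheck 5 3) = true := by decide +kernel
/-- (5,3): every shape with at most 5 leaves. -/
theorem budgetCheck_5_3_upTo5 : (shapesUpTo 5).all (budgetCheck 5 3) = true :=
  all_shapesUpTo_succ' budgetCheck_5_3_upTo4 (all_of_take_drop _ _ 7 budgetCheck_5_3_five_0 budgetCheck_5_3_five_1)

/-- (q,p) = (5,2): every shape with ≤ 4 leaves. -/
theorem budgetCheck_5_2_upTo4 : (shapesUpTo 4).all (budgetCheck 5 2) = true := by decide +kernel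
/-- (5,2), 5 leaves, first half. -/
theorem budgetCheck_5_2_five_0 : ((shapesN 5).take 7).all (budgetCheck 5 2) = true := by decide +kernel
/-- (5,2), 5 leaves, second half. -/
theorem budgetCheck_5_2_five_1 : ((shapesN 5).drop 7).all (budgetCheck 5 2) = true := by decide +kernel
/-- (5,2): every shape with at most 5 leaves. -/
theorem budgetCheck_5_2_upTo5 : (shapesUpTo 5).all (budgetCheck 5 2) = true :=
  all_shapesUpTo_succ' budgetCheck_5_2_upTo4 (all_of_take_drop _ _ 7 budgetCheck_5_2_five_0 budgetCheck_5_2_five_1)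

/-- The 43-leaf GOOD-ACTIVE counterexample `gaCex43` (part 6e) at (5,3). -/
theorem budgetCheck_gaCex43 : budgetCheck 5 3 (shapeOf gaCex43) = true := by decide +kernel

end Certificates

/-! ## Conjecture D for the certified classes at q = 5 -/

section Consequences

variable {emin : ℤ} {fl flp : ℚ → ℚ}

/-- **CONJECTURE D AT (5,3) FOR EVERY TREE WITH AT MOST 5 SUMMANDS.** -/
theorem conjectureD_5_3_of_le_five (hfl : IsRoundNearest 5 emin fl) (hflp : IsRoundNearest 3 emin flp)
    (t : SumTree) (ht : ∀ x ∈ leaves t, IsFloat 5 emin x ∧ 0 ≤ x) (hn : (leaves t).length ≤ 5) :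
    exact t ≤ treeQf (unitRoundoff 5) t (unitRoundoff 3) * flp (eval fl t) :=
  exact_le_treeQf_mul_fl_of_budgetCheck (by norm_num) (by norm_num) hfl hflp t ht
    (budgetCheck_of_all budgetCheck_5_3_upTo5 t hn)

/-- **CONJECTURE D AT (5,2) FOR EVERY TREE WITH AT MOST 5 SUMMANDS.** -/
theorem conjectureD_5_2_of_le_five (hfl : IsRoundNearest 5 emin fl) (hflp : IsRoundNearest 2 emin flp)
    (t : SumTree) (ht : ∀ x ∈ leaves t, IsFloat 5 emin x ∧ 0 ≤ x) (hn : (leaves t).length ≤ 5) :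
    exact t ≤ treeQf (unitRoundoff 5) t (unitRoundoff 2) * flp (eval fl t) :=
  exact_le_treeQf_mul_fl_of_budgetCheck (by norm_num) (by norm_num) hfl hflp t ht
    (budgetCheck_of_all budgetCheck_5_2_upTo5 t hn)

/-- **CONJECTURE D FOR EVERY TREE OF THE SHAPE OF `gaCex43` AT (5,3).** -/
theorem conjectureD_gaCex43 (hfl : IsRoundNearest 5 emin fl) (hflp : IsRoundNearest 3 emin flp)
    (t : SumTree) (ht : ∀ x ∈ leaves t, IsFloat 5 emin x ∧ 0 ≤ x) (hs : shapeOf t = shapeOf gaCex43) :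
    exact t ≤ treeQf (unitRoundoff 5) t (unitRoundoff 3) * flp (eval fl t) :=
  exact_le_treeQf_mul_fl_of_budgetCheck (by norm_num) (by norm_num) hfl hflp t ht
    (hs ▸ budgetCheck_gaCex43)

end Consequences

end Summit.Ventures.CertifiedArithmetic.LowPrec.Opt
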